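import Summits.MatrixMultiplication.MatrixMultiplication.Theses.FidelityWitnesses
import Literature.Computability.AlgebraicComplexity.AlderStrassenProofs

/-!
# Line `spectral-persistence` for crux `FidelityWitnesses.LinearDefectLaw` (stmt-MatrixMultiplication-14039)

Skeleton (crux-plan, planner-cruxplan-stmt-MatrixMultiplication-14039-spectral-persistence-0, 2026-08-16)
of crux idea `Cruxes/LinearDefectLaw/Ideas/spectral-persistence.md` (crux-ideate r1, ideator 3; triage
r1-1/2/3: **pass**, with the sharpenings built in — see the line card `Lines/spectral-persistence.md`; this file is published as `Lines/spectral_persistence.lean`).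

THE CRUX. `LinearDefectLaw : ∀ n r S, tensorRank S ≤ r →
‖Σ S·⟨n,n,n⟩‖² ≤ (n³ + r − R̲(⟨n,n,n⟩))·Σ‖S‖²`, i.e. `M(n,r) ≤ n³ − (R̲ − r)`, i.e.
`dist(⟨n,n,n⟩, σ̂_r)² ≥ R̲(⟨n,n,n⟩) − r` (`R̲` = the tree's `algBorderRank` over `ℂ`).

THE LINE (residual spectral persistence; the shared lever of the three passing r1 cards, in the
MAXIMISER packaging of this card). Write `T = ⟨n,n,n⟩`, `σ̂_r := closure {S | R(S) ≤ r}` (a closed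
cone; `= {R̲ ≤ r}` by Alder–Strassen, a tree THEOREM `alder_secantVariety_eq_setOf_algBorderRank_le_holds`).
A FIDELITY MAXIMISER at level `r` is a point `S ∈ σ̂_r` at optimal scale (`Σ S·T = Σ‖S‖²`, so
`E := T − S ⊥ S` and `‖E‖² = n³ − Σ‖S‖²`) whose fidelity `|Σ S'·T|²/Σ‖S'‖²` no honest rank-`≤ r` tensor `S'`
exceeds (the three hypotheses `S ∈ closure …`, `overlap S = normSq S`, `∀ S', … ≤ normSq S * normSq S'`
below); then `Σ‖S‖² = M(n,r)` and `S` is a nearest point of `σ̂_r` to `T`.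
* `stub_maximiserExists` (M): maximisers exist at every level (the unit sphere of the closed cone `σ̂_r` is
  compact; rescale the maximiser of `|Σ S·T|²` on it).
* `stub_twoPlaneGain` (M): TWO-PLANE BESSEL — for `S ∈ σ̂_r` at optimal scale and unit `x, y, z`,
  projecting `T` on `span{S, x̄⊗ȳ⊗z̄} ⊂ σ̂_{r+1}` captures `≥ Σ‖S‖² + |E(x,y,z)|²`; by density honest
  rank-`≤ r+1` tensors get within any `δ` of it. (The tensor shadow of `σ_{k+1}(P) = ‖P − P_k‖_op`.)
* `stub_freeUnitProduct` (M): below the concise range (`r ≤ 2n − 2`) EVERY point of `σ̂_r` is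
  trilinearly orthogonal to a rotated unit product `(p⊗q)⊗(p̄⊗s)⊗(s̄⊗q̄)` of `T` (kernel counting:
  `≤ n − 1` linear conditions on `p`, then `≤ n − 1` on `s`; closure by compactness of the product sphere),
  on which `T` evaluates to `1` — the first `2n − 1` rungs of the law are unconditional.
* `stub_residualSpectralLaw` (XL, THE LEVER, hardest): in the concise range `r ≥ 2n − 1`, at every
  maximiser `S ≠ T` the residual keeps spectral norm `≥ 1 = ‖T‖_σ`: some unit `x, y, z` have
  `|(T − S)(x,y,z)| ≥ 1` (RSL ≡ URL ≡ SpectralResidual of the sibling cards; bR-free, local, one tensor,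
  one inequality; tight at every digital rung: `tight_two_six`, Bini at `(2,5)`).
* `LinearDefectLaw_of` — the kernel-checked composition (no `sorry` of its own): the four stubs give the
  UNIT SLOPE `M(n,r) ≤ M(n,r+1) − 1` for `r < R̲(T)` (`unit_slope`: a maximiser `S` at level `r` has
  `S ≠ T` by Alder, since `T ∈ σ̂_r` would give `R̲(T) ≤ r`; RSL / the free product give `|E(x,y,z)| ≥ 1`;
  two-plane gain and the level-`(r+1)` bound squeeze `Σ‖S‖² ≤ c − 1`; maximality transfers it to every
  honest `S₀`), then Ideator-2's downward telescoping from the Cauchy–Schwarz level `r = R̲(T)` (constant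
  `n³`, `law_at_defect`) proves the crux.

Disproof.lean (cdisprove cycle 1, read 2026-08-16T05Z) — what the stub set honours:
`false_without_rank` (H = the rank bound): used at `stub_twoPlaneGain` (the added triad lands in level
`r + 1`) and in the maximiser hypotheses (`S ∈ σ̂_r`); `tight_two_six` / `tight_two_five` / `MredZ_vals`:
equality cases of `stub_residualSpectralLaw` (`E` = one unit product, resp. Bini's missing pair,
`‖E‖_σ = 1` exactly), so no slack is claimed anywhere (`not_linearDefectLaw_slack`,
`not_lawTwo_five_strengthened` respected); `not_additive_at_five`: the line bounds increments from BELOW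
only (`≥ 1`), compatible with the super-additive rungs `(2,3), (2,4)`; `linearDefectLaw_implies`: the
composition re-derives `SixEighthsAtFive ∧ SevenEighthsLaw` only through RSL at `(2,5), (2,6)`, where RSL
is tight — the lead should expect the `(2,6)` instance of `stub_residualSpectralLaw` to be as hard as
`SevenEighthsLaw`. LANDED Negative lemmas: `Theorems/LinearDefectLaw/Negative/TwoByTwoRungs.lean` (p76350:
`linearDefectLaw_false_without_rank`, `_tight_two_six`, `_tight_two_five`, `_not_slack`,
`_not_additive_at_five`, `_not_two_five_strengthened`, `_not_of_int`, `_two`) — the same content; no stub is an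
instance of any of them (checked in a scratch file importing that module, rc 0, which also re-derives
`SixEighthsAtFive`/`SevenEighthsLaw` from `LinearDefectLaw_of` via `linearDefectLaw_two`); `ledger negatives
--problem MatrixMultiplication` (4 STPP / design refutations) is disjoint from every stub. REFUTED MECHANISM NOT USED:
the card's PRL/NRL ("`T` is a nuclear-norm dual certificate of the residual", separable residual) is dead at
`(2,3), (2,4)` (TRIAGE-r1-3 § Numbers T3/T4: `E_op` not Hermitian, `λ_min = −0.29`) and appears in no stub.

No `Prop`-valued definitions are introduced (landing-friendly: the proved file is this file with the four
`sorry`s discharged); the vocabulary is three data definitions `overlap`, `normSq`, `eval₃`.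
-/

noncomputable section

namespace Summit.MatrixMultiplication.MatrixMultiplication.Cruxes.LinearDefectLaw.SpectralPersistence

open scoped BigOperators ComplexConjugate
open Literature.Computability.AlgebraicComplexity
open Summit.MatrixMultiplication.MatrixMultiplication.Theses.FidelityWitnesses (LinearDefectLaw)

set_option linter.unusedVariables false
set_option linter.dupNamespace false

/-! ## Vocabulary (data only) -/

/-- One slot of `⟨n,n,n⟩`: index pairs (`a = (κ,ν)`, `b = (κ,μ)`, `c = (μ,ν)` in `matMulTensor`). -/
abbrev P (n : ℕ) : Type := Fin n × Fin n

/-- The crux's numerator before `‖·‖²`: the bilinear overlap `Σ S·⟨n,n,n⟩` (no conjugation; `T` is real,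
so `|Σ S·T| = |⟨S,T⟩|`). -/
def overlap {n : ℕ} (S : P n → P n → P n → ℂ) : ℂ :=
  ∑ a, ∑ b, ∑ c, S a b c * matMulTensor ℂ n n n a b c

/-- The crux's squared Frobenius norm `Σ‖S_{abc}‖²`. -/
def normSq {n : ℕ} (S : P n → P n → P n → ℂ) : ℝ :=
  ∑ a, ∑ b, ∑ c, ‖S a b c‖ ^ 2

/-- Trilinear evaluation `E(x,y,z) = Σ E_{abc} x_a y_b z_c`; `sup |E(x,y,z)|` over unit `x, y, z`
(`Σ_i ‖x_i‖² = 1`, etc.) is the spectral (injective) norm `‖E‖_σ`, and `‖⟨n,n,n⟩‖_σ = 1`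
(`|tr(XYZ)| ≤ ‖X‖_F‖Y‖_F‖Z‖_F`). -/
def eval₃ {n : ℕ} (E : P n → P n → P n → ℂ) (x y z : P n → ℂ) : ℂ :=
  ∑ a, ∑ b, ∑ c, E a b c * x a * y b * z c

/-! ## The stubs (registered; `sorry` lives only here)

A MAXIMISER of level `r` is an `S` with the three properties
`S ∈ closure {S' | tensorRank S' ≤ r}` (the closed cone `σ̂_r`), `overlap S = normSq S` (optimal scale:
`T − S ⊥ S`), `∀ S', tensorRank S' ≤ r → ‖overlap S'‖² ≤ normSq S * normSq S'` (no honest rank-`≤ r`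
tensor has larger fidelity); then `normSq S = M(n,r) = n³ − dist(T, σ̂_r)²`. -/

/-- **Stub 1 — maximisers exist at every level.** Why plausibly true: `σ̂_r` is a closed CONE (closure of a
set stable under `ℂ`-scaling), so its unit sphere `{S ∈ σ̂_r | Σ‖S‖² = 1}` is compact (closed and bounded in a
finite-dimensional space; mind that the ambient Pi norm is the sup norm while `normSq` is the `ℓ²` form) and the
continuous `S ↦ ‖Σ S·T‖²` attains its max `M` at some unit `S₁` (if the sphere is empty, i.e. `n = 0` or
`r = 0`, take `S = 0`, using `exists_eq_sum_triad_of_tensorRank_le` to see that rank `≤ 0` means `S' = 0`);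
put `S := conj(Σ S₁·T) • S₁`: then `Σ S·T = |Σ S₁·T|² = Σ‖S‖²`, `S ∈ σ̂_r`, and every honest `S' ≠ 0` of rank
`≤ r` has `S'/‖S'‖` on the sphere, so `‖Σ S'·T‖² ≤ M·Σ‖S'‖²`. Mathlib: `IsCompact.exists_isMaxOn`,
`Metric.isCompact_of_isClosed_isBounded` / `ProperSpace`, continuity of finite sums. Size M. -/
theorem stub_maximiserExists :
    ∀ n r : ℕ, ∃ S : P n → P n → P n → ℂ,
      S ∈ closure {S' : P n → P n → P n → ℂ | tensorRank S' ≤ r} ∧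
      overlap S = ((normSq S : ℝ) : ℂ) ∧
      ∀ S' : P n → P n → P n → ℂ, tensorRank S' ≤ r → ‖overlap S'‖ ^ 2 ≤ normSq S * normSq S' := by
  sorry

/-- **Stub 2 — two-plane gain** (the one-step / telescoping identity of the sibling cards, closure form).
From `S ∈ σ̂_r` at optimal scale and unit `x, y, z`, honest rank-`≤ r+1` tensors capture, up to any `δ > 0`,
at least `Σ‖S‖² + |(T − S)(x,y,z)|²`. Why plausibly true (paper proof, checked by all three triagers): with
the Hermitian product `⟨A,B⟩ = Σ conj(A)·B` and `T` real, optimal scale means `E := T − S ⊥ S`;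
`u := conj(x⊗y⊗z)` is a unit rank-one tensor with `⟨u,E⟩ = E(x,y,z) =: e`. If `S = 0`, `S' := u` works
(`|Σ u·T|² = |e|²`). Else `W := span{S,u}`: with `u' := u − (⟨S,u⟩/‖S‖²)S` one has `⟨u',T⟩ = ⟨u, T − S⟩ = e`
and `‖u'‖² ≤ 1`, so `S'' := P_W T` satisfies `Σ S''·T = ‖S''‖² = ‖S‖² + |e|²/‖u'‖² ≥ Σ‖S‖² + |e|²`
(Bessel on the orthonormal pair `S/‖S‖, u'/‖u'‖`; if `u' = 0` then `e = 0`). `S'' ∈ σ̂_r + ℂu ⊆ σ̂_{r+1}`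
(`tensorRank_add_le`, rank-one `u`), `S'' ≠ 0`, and fidelity is continuous at `S'' ≠ 0`, so honest
rank-`≤ r+1` tensors `S'` come within `δ`: `‖Σ S'·T‖² ≥ (Σ‖S‖² + |e|² − δ)·Σ‖S'‖²`, `Σ‖S'‖² > 0`. Vacuous at
`n = 0` (no unit vectors). Mathlib: `Metric.mem_closure_iff`, `Finset.sum_mul_sq_le_sq_mul_sq` / `norm_inner_le_norm`,
`tensorRank_le_of_eq_sum`, `tensorRank_add_le`. Size M (explicit two-vector Gram–Schmidt in coordinates). -/
theorem stub_twoPlaneGain :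
    ∀ (n r : ℕ) (S : P n → P n → P n → ℂ) (x y z : P n → ℂ),
      S ∈ closure {S' : P n → P n → P n → ℂ | tensorRank S' ≤ r} →
      overlap S = ((normSq S : ℝ) : ℂ) →
      (∑ i, ‖x i‖ ^ 2) = 1 → (∑ i, ‖y i‖ ^ 2) = 1 → (∑ i, ‖z i‖ ^ 2) = 1 →
      ∀ δ : ℝ, 0 < δ →
        ∃ S' : P n → P n → P n → ℂ, tensorRank S' ≤ r + 1 ∧ 0 < normSq S' ∧
          (normSq S + ‖eval₃ (matMulTensor ℂ n n n - S) x y z‖ ^ 2 - δ) * normSq S' ≤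
            ‖overlap S'‖ ^ 2 := by
  sorry

/-- **Stub 3 — free unit product below the concise range** (= `URL_lowRank` / `FreeRotatedProductSmall` of
the sibling cards, closure form): for `r ≤ 2n − 2` every `S ∈ σ̂_r` is trilinearly orthogonal to a rotated
unit product of `⟨n,n,n⟩` on which `T` evaluates to `1`. Why plausibly true: for an HONEST
`S = Σ_{l<r} w_l⊗u_l⊗v_l` (`exists_eq_sum_triad_of_tensorRank_le`) and `x = p⊗q`, `y = p̄⊗s`, `z = s̄⊗q̄`
(`x_{(κ,ν)} = p_κ q_ν`, `y_{(κ,μ)} = conj(p_κ) s_μ`, `z_{(μ,ν)} = conj(s_μ) conj(q_ν)`) one has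
`S(x,y,z) = Σ_l (pᵀ W_l q)(p^* U_l s)(Σ v_l z)` and `T(x,y,z) = ‖p‖²‖q‖²‖s‖²` (the support of `matMulTensor`
is `a.1 = b.1, b.2 = c.1, a.2 = c.2`); split the `r ≤ 2n − 2` indices into `L₁ ⊔ L₂` of sizes `≤ n − 1`, fix a
unit `q`, choose a unit `p` in the kernel of the `≤ n − 1` linear forms `p ↦ pᵀ W_l q` (`l ∈ L₁`) and then a
unit `s` in the kernel of `s ↦ p^* U_l s` (`l ∈ L₂`) (dimension count in `ℂⁿ`: `LinearMap.ker_ne_bot_of_finrank_lt`,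
`Submodule.exists_mem_ne_zero_of_ne_bot`): every term dies. For `S ∈ σ̂_r` take honest
`S_k → S` with such unit triples `(x_k,y_k,z_k)`, extract a convergent subsequence on the compact product of
spheres (`IsCompact.tendsto_subseq`), and pass to the limit in the continuous `eval₃` (`T(x,y,z) = 1` is a
closed condition). Needs no optimality of `S`. Size M. -/
theorem stub_freeUnitProduct :
    ∀ (n r : ℕ) (S : P n → P n → P n → ℂ), r + 2 ≤ 2 * n →
      S ∈ closure {S' : P n → P n → P n → ℂ | tensorRank S' ≤ r} →
      ∃ x y z : P n → ℂ, (∑ i, ‖x i‖ ^ 2) = 1 ∧ (∑ i, ‖y i‖ ^ 2) = 1 ∧ (∑ i, ‖z i‖ ^ 2) = 1 ∧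
        eval₃ S x y z = 0 ∧ eval₃ (matMulTensor ℂ n n n) x y z = 1 := by
  sorry

/-- **Stub 4 — the RESIDUAL SPECTRAL LAW in the concise range (THE LEVER; hardest stub; open).**
For `r ≥ 2n − 1`, at every maximiser `S ≠ ⟨n,n,n⟩` of level `r` some unit `x, y, z` have
`|(T − S)(x,y,z)| ≥ 1`, i.e. `‖T − S‖_σ ≥ 1 = ‖T‖_σ`: what is still missing always contains one whole unit
triad's worth of overlap. Why plausibly true: (i) exact matrix model — for `P` with unit singular values the
best rank-`k` residual has `‖P − P_k‖_op = σ_{k+1} = 1` (Eckart–Young–Mirsky); (ii) TIGHT equality at every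
digital rung (`E` = sum of the missed unit products: `(2,5)` Bini `MredZ_vals` / `tight_two_five`, `(2,6)`
`tight_two_six`, all partial matrix multiplications); (iii) numerics, four independent codes incl. pure-Lean
`Float` (TRIAGE-r1-3 T3–T6, kit j010651, j012293-B/C, j012313-B, j012315): `‖E_r‖_σ = 1.004982` at `(2,3)`,
`∈ [1.0618, 1.0740]` at `(2,4)`, `∈ [1.00006, 1.00011]` at `(2,5)`, `= 1` at `(2,6)`; Smirnov-seeded window
points `(3,16…19)`: `[1.0019, 1.42]`, `[1.00018, 1.0029]`, `[1.00004, 1.0004]`, `[1.154, 1.201]`; 21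
rectangular rungs of `⟨2,2,3⟩, ⟨2,2,4⟩, ⟨2,3,3⟩` never below `1` — no computed nearest point violates it, and
it is PINNED at `1⁺` at most analog rungs (an active-constraint signature). Surviving mechanism menu (the
card's PRL/NRL is REFUTED — do not use it): first-order optimality of `S` (`σ̂_r` is stable under
`GL(V₁)×GL(V₂)×GL(V₃)`, so the critical Gram identity `S_(p)T_(p)^* = S_(p)S_(p)^* = nK_p`, `0 ⪯ K_p ⪯ I`,
`R_(p)R_(p)^* = n(I − K_p)` holds in each mode — Ideator-1 L1/L2, triage-verified, provable now) plus the
NODAL form (some perfect triad `t` with `Re Σ S·t̄ ≤ 0`; numerically `−0.0039` at `(2,3)`, `−0.035` at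
`(2,4)`, `0` at digital rungs), which implies the stub with the triad EXHIBITED
(`|(T − S)(t)| ≥ Re (1 − S(t)) ≥ 1`). Degenerate cases: `n = 0` (`S ≠ T` is false on the one-point tensor
space) and `r ≥ R̲(T)` (the only maximiser is `T`) are vacuous; `S ≠ 0` since `r ≥ 1`. Why it might fail:
an analog nearest point in the window `[2n² − n, R̲)` at `n ≥ 3` with a diffuse residual
(`‖E‖_σ < 1 ≤ ‖E‖_F`) — untested there because global optima are not computable (ALS misses Smirnov-type
border structure). Size XL. -/
theorem stub_residualSpectralLaw :
    ∀ (n r : ℕ) (S : P n → P n → P n → ℂ), 2 * n ≤ r + 1 →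
      S ∈ closure {S' : P n → P n → P n → ℂ | tensorRank S' ≤ r} →
      overlap S = ((normSq S : ℝ) : ℂ) →
      (∀ S' : P n → P n → P n → ℂ, tensorRank S' ≤ r → ‖overlap S'‖ ^ 2 ≤ normSq S * normSq S') →
      S ≠ matMulTensor ℂ n n n →
      ∃ x y z : P n → ℂ, (∑ i, ‖x i‖ ^ 2) = 1 ∧ (∑ i, ‖y i‖ ^ 2) = 1 ∧ (∑ i, ‖z i‖ ^ 2) = 1 ∧
        1 ≤ ‖eval₃ (matMulTensor ℂ n n n - S) x y z‖ := by
  sorry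

/-! ## Proved glue, part 1: elementary facts -/

theorem normSq_nonneg {n : ℕ} (S : P n → P n → P n → ℂ) : 0 ≤ normSq S := by
  unfold normSq; positivity

/-- `eval₃` is additive in the tensor: `(T − S)(x,y,z) = T(x,y,z) − S(x,y,z)`. -/
theorem eval₃_sub {n : ℕ} (E F : P n → P n → P n → ℂ) (x y z : P n → ℂ) :
    eval₃ (E - F) x y z = eval₃ E x y z - eval₃ F x y z := by
  unfold eval₃
  simp only [Pi.sub_apply, sub_mul, Finset.sum_sub_distrib]

/-- Alder–Strassen (tree theorem), in the direction the glue uses: a limit of rank-`≤ r` tensors has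
`R̲ ≤ r`. -/
theorem algBorderRank_le_of_mem_closure {n r : ℕ} {S : P n → P n → P n → ℂ}
    (hS : S ∈ closure {S' : P n → P n → P n → ℂ | tensorRank S' ≤ r}) : algBorderRank S ≤ r :=
  (mem_closure_setOf_tensorRank_le_iff alder_secantVariety_eq_setOf_algBorderRank_le_holds r S).1 hS

theorem norm_matMulTensor (n : ℕ) (a b c : P n) :
    ‖matMulTensor ℂ n n n a b c‖ = matMulTensor ℝ n n n a b c := by
  simp only [matMulTensor]
  split_ifs <;> simp

theorem sq_matMulTensor_real (n : ℕ) (a b c : P n) :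
    matMulTensor ℝ n n n a b c ^ 2 = matMulTensor ℝ n n n a b c := by
  simp only [matMulTensor]
  split_ifs <;> simp

/-- `Σ_{abc} ⟨n,n,n⟩_{abc} = n³` (number of unit products). [Ideator2Sketch, `sum_matMulTensor_real`] -/
theorem sum_matMulTensor_real (n : ℕ) :
    (∑ a : P n, ∑ b : P n, ∑ c : P n, matMulTensor ℝ n n n a b c) = (n : ℝ) ^ 3 := by
  have h1 : ∀ a b : P n,
      (∑ c : P n, matMulTensor ℝ n n n a b c) = if a.1 = b.1 then 1 else 0 := by
    intro a b
    by_cases hab : a.1 = b.1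
    · rw [if_pos hab, Finset.sum_eq_single (b.2, a.2)]
      · simp [matMulTensor, hab]
      · intro c _ hc
        simp only [matMulTensor]
        rw [if_neg]
        rintro ⟨-, h2, h3⟩
        exact hc (Prod.ext h2.symm h3.symm)
      · intro h
        exact absurd (Finset.mem_univ _) h
    · rw [if_neg hab]
      exact Finset.sum_eq_zero fun c _ => by
        simp [matMulTensor, hab]
  have h2 : ∀ a : P n, (∑ b : P n, if a.1 = b.1 then (1 : ℝ) else 0) = n := by
    intro a
    rw [Fintype.sum_prod_type, Finset.sum_comm]
    simp
  simp_rw [h1, h2]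
  simp [Finset.sum_const, Finset.card_univ, Fintype.card_prod, Fintype.card_fin]
  ring

/-- **Cauchy–Schwarz at `⟨n,n,n⟩`:** `|Σ S·T|² ≤ n³·Σ‖S‖²` for every `S` — the law at every level
`r ≥ R̲`, where its constant is `≥ n³`. [Ideator2Sketch, `overlap_sq_le`] -/
theorem overlap_sq_le {n : ℕ} (S : P n → P n → P n → ℂ) :
    ‖overlap S‖ ^ 2 ≤ (n : ℝ) ^ 3 * normSq S := by
  let f : P n × P n × P n → ℝ := fun p => ‖S p.1 p.2.1 p.2.2‖
  let g : P n × P n × P n → ℝ := fun p => matMulTensor ℝ n n n p.1 p.2.1 p.2.2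
  have hle : ‖overlap S‖ ≤ ∑ p, f p * g p := by
    have step : ‖overlap S‖ ≤ ∑ a, ∑ b, ∑ c, ‖S a b c‖ * matMulTensor ℝ n n n a b c := by
      unfold overlap
      refine (norm_sum_le _ _).trans (Finset.sum_le_sum fun a _ => ?_)
      refine (norm_sum_le _ _).trans (Finset.sum_le_sum fun b _ => ?_)
      refine (norm_sum_le _ _).trans (Finset.sum_le_sum fun c _ => ?_)
      rw [norm_mul, norm_matMulTensor]
    simpa only [Fintype.sum_prod_type] using step
  have hf : (∑ p, f p ^ 2) = normSq S := by
    unfold normSq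
    simp only [Fintype.sum_prod_type, f]
  have hg : (∑ p, g p ^ 2) = (n : ℝ) ^ 3 := by
    rw [← sum_matMulTensor_real n]
    simp only [Fintype.sum_prod_type, g, sq_matMulTensor_real]
  have hcs : (∑ p, f p * g p) ^ 2 ≤ (∑ p, f p ^ 2) * ∑ p, g p ^ 2 :=
    Finset.sum_mul_sq_le_sq_mul_sq _ _ _
  rw [hf, hg] at hcs
  calc ‖overlap S‖ ^ 2 ≤ (∑ p, f p * g p) ^ 2 := pow_le_pow_left₀ (norm_nonneg _) hle 2
    _ ≤ normSq S * (n : ℝ) ^ 3 := hcs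
    _ = (n : ℝ) ^ 3 * normSq S := mul_comm _ _

/-! ## Proved glue, part 2: the four stubs give the unit slope -/

/-- RSL at EVERY level (stubs 3 + 4): at a maximiser `S ≠ T` some unit `x,y,z` have `|(T − S)(x,y,z)| ≥ 1` —
below the concise range the free unit product gives `|1 − 0|`, in the concise range it is stub 4. -/
theorem residual_ge_one (n r : ℕ) (S : P n → P n → P n → ℂ)
    (hcl : S ∈ closure {S' : P n → P n → P n → ℂ | tensorRank S' ≤ r})
    (hsc : overlap S = ((normSq S : ℝ) : ℂ))
    (hmax : ∀ S' : P n → P n → P n → ℂ, tensorRank S' ≤ r → ‖overlap S'‖ ^ 2 ≤ normSq S * normSq S')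
    (hne : S ≠ matMulTensor ℂ n n n) :
    ∃ x y z : P n → ℂ, (∑ i, ‖x i‖ ^ 2) = 1 ∧ (∑ i, ‖y i‖ ^ 2) = 1 ∧ (∑ i, ‖z i‖ ^ 2) = 1 ∧
      1 ≤ ‖eval₃ (matMulTensor ℂ n n n - S) x y z‖ := by
  rcases Nat.lt_or_ge (r + 1) (2 * n) with hlt | hge
  · obtain ⟨x, y, z, hx, hy, hz, h0, h1⟩ := stub_freeUnitProduct n r S (by omega) hcl
    refine ⟨x, y, z, hx, hy, hz, ?_⟩
    rw [eval₃_sub, h1, h0, sub_zero, norm_one]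
  · exact stub_residualSpectralLaw n r S hge hcl hsc hmax hne

/-- **UNIT SLOPE (the transferred crux `C⁺`, Ideator-2's bR-free form) from the four stubs.** At level
`r < R̲(T)`: if `c` bounds the fidelity at level `r + 1`, then `c − 1` bounds it at level `r`. Proof: take a
maximiser `S` (stub 1); `S ≠ T` since `T ∈ σ̂_r` would force `R̲(T) ≤ r` (Alder–Strassen, tree theorem);
stubs 3/4 give unit `x,y,z` with `|E(x,y,z)| ≥ 1`; stub 2 and the level-`(r+1)` bound `c` give
`Σ‖S‖² + 1 − δ ≤ c` for every `δ > 0`; and maximality of `S` transfers `Σ‖S‖² ≤ c − 1` to every honest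
`S₀` of rank `≤ r`. -/
theorem unit_slope (n r : ℕ) (c : ℝ) (hr : r < algBorderRank (matMulTensor ℂ n n n))
    (hc : ∀ S' : P n → P n → P n → ℂ, tensorRank S' ≤ r + 1 → ‖overlap S'‖ ^ 2 ≤ c * normSq S')
    (S₀ : P n → P n → P n → ℂ) (hS₀ : tensorRank S₀ ≤ r) :
    ‖overlap S₀‖ ^ 2 ≤ (c - 1) * normSq S₀ := by
  obtain ⟨S, hcl, hsc, hmax⟩ := stub_maximiserExists n r
  have hne : S ≠ matMulTensor ℂ n n n := by
    intro hST
    have hle : algBorderRank (matMulTensor ℂ n n n) ≤ r := by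
      have h1 := algBorderRank_le_of_mem_closure hcl
      rwa [hST] at h1
    omega
  obtain ⟨x, y, z, hx, hy, hz, h1⟩ := residual_ge_one n r S hcl hsc hmax hne
  set e : ℝ := ‖eval₃ (matMulTensor ℂ n n n - S) x y z‖ with he
  have he1 : 1 ≤ e ^ 2 := by nlinarith [h1, norm_nonneg (eval₃ (matMulTensor ℂ n n n - S) x y z)]
  -- squeeze: `normSq S + e² - δ ≤ c` for every `δ > 0`
  have hsq : ∀ δ : ℝ, 0 < δ → normSq S + e ^ 2 - δ ≤ c := by
    intro δ hδ
    obtain ⟨S', hS'r, hS'pos, hS'⟩ := stub_twoPlaneGain n r S x y z hcl hsc hx hy hz δ hδ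
    have hcS' := hc S' hS'r
    by_contra hlt
    rw [not_le] at hlt
    have : c * normSq S' < (normSq S + e ^ 2 - δ) * normSq S' :=
      mul_lt_mul_of_pos_right hlt hS'pos
    linarith
  have hM : normSq S ≤ c - 1 := by
    by_contra hlt
    rw [not_le] at hlt
    have := hsq ((normSq S - (c - 1)) / 2) (by linarith)
    linarith
  calc ‖overlap S₀‖ ^ 2 ≤ normSq S * normSq S₀ := hmax S₀ hS₀
    _ ≤ (c - 1) * normSq S₀ := mul_le_mul_of_nonneg_right hM (normSq_nonneg S₀)

/-! ## Proved glue, part 3: downward telescoping (Ideator-2's `linearDefectLaw_of_unitSlope`) -/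

/-- For every `k` and every `r` with `r + k = R̲(T)`: the constant `n³ − k` bounds the fidelity at level
`r` (induction on `k` from the Cauchy–Schwarz level, one `unit_slope` per step). -/
theorem law_at_defect (n : ℕ) :
    ∀ k r : ℕ, r + k = algBorderRank (matMulTensor ℂ n n n) →
      ∀ S₀ : P n → P n → P n → ℂ, tensorRank S₀ ≤ r →
        ‖overlap S₀‖ ^ 2 ≤ ((n : ℝ) ^ 3 - k) * normSq S₀ := by
  intro k
  induction k with
  | zero =>
    intro r _ S₀ _
    simpa using overlap_sq_le S₀
  | succ k ih =>
    intro r hr S₀ hS₀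
    have hlt : r < algBorderRank (matMulTensor ℂ n n n) := by omega
    have hyp : ∀ S' : P n → P n → P n → ℂ, tensorRank S' ≤ r + 1 →
        ‖overlap S'‖ ^ 2 ≤ ((n : ℝ) ^ 3 - k) * normSq S' := ih (r + 1) (by omega)
    have key := unit_slope n r ((n : ℝ) ^ 3 - k) hlt hyp S₀ hS₀
    have e : (n : ℝ) ^ 3 - (k : ℝ) - 1 = (n : ℝ) ^ 3 - ((k + 1 : ℕ) : ℝ) := by
      push_cast; ring
    rw [e] at key
    exact key

/-! ## The composition (kernel-checked; its only `sorry`s are the four stubs it rests on) -/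

/-- **`LinearDefectLaw` from the four stubs**: telescoping down from the Cauchy–Schwarz level
`r = R̲(⟨n,n,n⟩)` (`law_at_defect`); for `r > R̲` the constant exceeds `n³` and Cauchy–Schwarz suffices. -/
theorem LinearDefectLaw_of : LinearDefectLaw := by
  intro n r S hS
  set b : ℕ := algBorderRank (matMulTensor ℂ n n n) with hb
  have goal : ‖overlap S‖ ^ 2 ≤ ((n : ℝ) ^ 3 + (r : ℝ) - (b : ℝ)) * normSq S := by
    by_cases hrb : r ≤ b
    · obtain ⟨k, hk⟩ : ∃ k, r + k = b := ⟨b - r, by omega⟩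
      have hcast : (n : ℝ) ^ 3 + (r : ℝ) - (b : ℝ) = (n : ℝ) ^ 3 - (k : ℝ) := by
        have : (b : ℝ) = (r : ℝ) + (k : ℝ) := by exact_mod_cast hk.symm
        rw [this]; ring
      rw [hcast]
      exact law_at_defect n k r (by rw [hk]) S hS
    · have hbr : (b : ℝ) ≤ (r : ℝ) := by exact_mod_cast (Nat.lt_of_not_le hrb).le
      calc ‖overlap S‖ ^ 2 ≤ (n : ℝ) ^ 3 * normSq S := overlap_sq_le S
        _ ≤ ((n : ℝ) ^ 3 + (r : ℝ) - (b : ℝ)) * normSq S := by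
          apply mul_le_mul_of_nonneg_right _ (normSq_nonneg S)
          linarith
  simpa only [overlap, normSq] using goal

end Summit.MatrixMultiplication.MatrixMultiplication.Cruxes.LinearDefectLaw.SpectralPersistence

end
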